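import Literature.Algebra.Homology.OrderedCechPairSystemCrossTensor
import Literature.Algebra.Homology.OrderedCechPairSystemCrossMap
import Literature.Algebra.Homology.KunnethMap
import HarnessLib

/-!
# The Künneth comparison `Hⁿ(× ∘ totalTensorIso) ∘ κ` of two ordered Čech complexes READ ON COCHAINS AND CLASSES
# (The Stacks Project, Tag 0BEC; Eilenberg–Mac Lane 1953 §5; Weibel Thm. 3.6.3)

Layer `Literature/Algebra/Homology`, PROOF lane (theorems only; no definition, no instance, no notation, no `sorry`).  Pure homological
algebra over a commutative ring `A`: for systems `M` on `ι`, `N` on `κ` (finite index types), the F-K3 comparison map of ★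
`Algebra/Homology/OrderedCechPairSystemKunneth.bijective_homologyMap_tensor_cross` is `Hⁿ(Φ)` for the chain map
`Φ := (totalTensorIso M N).hom ≫ × : Č(M) ⊗ Č(N) ⟶ Tot Č•,•(M ⊠ N) ⟶ Č(lexSystem (M ⊠ N))` (★ `OrderedCechSystemBicomplex.totalTensorIso`,
★ `OrderedCechPairSystemCrossMap`: `× = totalDescHom … crossComponent …`).  This file unfolds it:
* §1 `totalTensorIso_hom_f_ιTensorObj` — on the summand `Čᵃ(M) ⊗ Čᵇ(N)` of `(Č(M) ⊗ Č(N))ⁿ` (Mathlib `HomologicalComplex.ιTensorObj`),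
  `totalTensorIso` is `ι_{a,b} ∘ tensorCochainEquiv` (`f ⊗ g ↦ ((τ, σ) ↦ f σ ⊗ g τ)`); `cross_totalTensorIso_f_ιTensorObj` — hence `Φ` reads
  `crossComponent (M ⊠ N) a b n ∘ tensorCochainEquiv` there; with ★ F0P1a-p02 (g3) `crossComponent_tensorCochainEquiv_tmul`:
  **`cross_totalTensorIso_f_ιTensorObj_tmul`** — `Φⁿ(ι_{a,b}(f ⊗ g))_T = f(front π₁-word of T)| ⊗ g(back π₂-word of T)|` (signed alternating
  evaluations, ★ `SysCochain.altEvalAt`), the Alexander–Whitney formula.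
* §2 ON CLASSES: **`homologyMap_cross_totalTensorIso_kunnethComponent_π`** — `Hⁿ(Φ) (κ_{a,b} ([z] ⊗ [w]))` is the class of the cycle
  `cyclesMap Φ (z ⊗ w)` (★ `KunnethMap.homologyπ_tensor_kunnethComponent`, Mathlib `homologyπ_naturality`), whose underlying cochain is
  `crossComponent (M ⊠ N) a b n (tensorCochainEquiv (z ⊗ w))` (**`iCycles_cyclesMap_cross_totalTensorIso_cyclesTensorToCycles`**).
So a consumer who must identify `Hⁿ(e) ∘ Hⁿ(Φ) ∘ κ_{a,b}` with a cup product of pull-backs (the (G3)∕(iv-4) bridge «cross = p₁♯ ∪ p₂♯» of cell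
`hodgecm-mathlib`'s F-11 ∕ J3 Künneth packet: B-p06 (g15) supplier, F0P1b-p06 (g2) closer, F0P1a-p02 (g3) read-outs) compares two classes of
cycles through `cycles_ext` on ONE cochain identity.  HC_CM is proved only modulo the 7 printed citations until rung 0 closes — nothing here
bears on a summit statement.

## References
* [StacksProject] The Stacks Project, Tag 0BEC (Künneth formula via the Čech complex of the product cover), Tag 012K (total complexes).
* [EilenbergMacLane1953] S. Eilenberg, S. Mac Lane, *On the groups `H(Π,n)`, I*, Ann. of Math. 58 (1953), §5 (the map `f` ∕ Alexander–Whitney).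
* [Weibel1994] C. A. Weibel, *An introduction to homological algebra* (1994), Thm. 3.6.3 (the cross product `[z] ⊗ [w] ↦ [z ⊗ w]`).
-/

universe u

open CategoryTheory CategoryTheory.Limits MonoidalCategory TensorProduct HomologicalComplex

set_option backward.isDefEq.respectTransparency false

noncomputable section

namespace Literature.Algebra.Homology

namespace OrderedCech

variable {A : Type u} [CommRing A] {ι κ : Type} [LinearOrder ι] [LinearOrder κ] [Fintype ι] [Fintype κ]
  (M : Finset ι ⥤ ModuleCat.{u} A) (N : Finset κ ⥤ ModuleCat.{u} A)

/-! ## §1 On cochains -/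

/-- **`totalTensorIso` on the summand `Čᵃ(M) ⊗ Čᵇ(N)`**: `(totalTensorIso M N)ⁿ ∘ ι_{a,b} = ι_{a,b} ∘ tensorCochainEquiv_{a,b}`
(`HomologicalComplex₂.ιTotal_map` for `total.mapIso tensorBicomplexIso`). [cite: StacksProject, Tag 012K] [cite: StacksProject, Tag 0BEC] -/
theorem totalTensorIso_hom_f_ιTensorObj (a b n : ℤ) (h : a + b = n) (x : SysCochain M a ⊗[A] SysCochain N b) :
    ((totalTensorIso M N).hom.f n).hom ((HomologicalComplex.ιTensorObj (sysComplex M) (sysComplex N) a b n h).hom x) =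
      ((sysBicomplex (prodSystem M N)).ιTotal (ComplexShape.up ℤ) a b n h).hom (tensorCochainEquiv M N a b x) := by
  change ((HomologicalComplex.ιTensorObj (sysComplex M) (sysComplex N) a b n h ≫ (totalTensorIso M N).hom.f n).hom x) = _
  unfold totalTensorIso HomologicalComplex.ιTensorObj HomologicalComplex.ιMapBifunctor
  erw [HomologicalComplex₂.ιTotal_map]
  rfl

/-- **The Künneth comparison chain map on the summand `Čᵃ(M) ⊗ Čᵇ(N)`**: `(totalTensorIso ≫ ×)ⁿ ∘ ι_{a,b} = crossComponent_{a,b,n} ∘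
tensorCochainEquiv_{a,b}`. [cite: StacksProject, Tag 0BEC] [cite: EilenbergMacLane1953, §5] -/
theorem cross_totalTensorIso_f_ιTensorObj (a b n : ℤ) (h : a + b = n) (x : SysCochain M a ⊗[A] SysCochain N b) :
    (((totalTensorIso M N).hom ≫
        totalDescHom (sysBicomplex (prodSystem M N)) (sysComplex (lexSystem (prodSystem M N)))
          (fun a b n => ModuleCat.ofHom (crossComponent (prodSystem M N) a b n)) (crossComponent_comm (prodSystem M N))).f n).hom
      ((HomologicalComplex.ιTensorObj (sysComplex M) (sysComplex N) a b n h).hom x) =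
      crossComponent (prodSystem M N) a b n (tensorCochainEquiv M N a b x) := by
  rw [HomologicalComplex.comp_f, ModuleCat.hom_comp, LinearMap.comp_apply, totalTensorIso_hom_f_ιTensorObj]
  change ((sysBicomplex (prodSystem M N)).ιTotal (ComplexShape.up ℤ) a b n h ≫
      (totalDescHom (sysBicomplex (prodSystem M N)) (sysComplex (lexSystem (prodSystem M N)))
        (fun a b n => ModuleCat.ofHom (crossComponent (prodSystem M N) a b n)) (crossComponent_comm (prodSystem M N))).f n).hom
      (tensorCochainEquiv M N a b x) = _
  rw [ιTotal_cross_f]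
  rfl

/-- **Alexander–Whitney on pure tensors**: for `0 ≤ a`, `0 ≤ b`, `a + b = n`, cochains `f ∈ Čᵃ(M)`, `g ∈ Čᵇ(N)` and a chain `T` of `ι ×ₗ κ`,
`((totalTensorIso ≫ ×)ⁿ (ι_{a,b} (f ⊗ g)))_T = f(π₁-front word of T)|_{π₁T} ⊗ g(π₂-back word of T)|_{π₂T}` (signed alternating evaluations;
★ `crossComponent_tensorCochainEquiv_tmul`). [cite: EilenbergMacLane1953, §5] [cite: StacksProject, Tag 0BEC] -/
theorem cross_totalTensorIso_f_ιTensorObj_tmul {a b n : ℤ} (h : 0 ≤ a ∧ 0 ≤ b ∧ a + b = n) (f : SysCochain M a) (g : SysCochain N b)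
    (T : Simplex (ι ×ₗ κ) n) :
    (((totalTensorIso M N).hom ≫
        totalDescHom (sysBicomplex (prodSystem M N)) (sysComplex (lexSystem (prodSystem M N)))
          (fun a b n => ModuleCat.ofHom (crossComponent (prodSystem M N) a b n)) (crossComponent_comm (prodSystem M N))).f n).hom
      ((HomologicalComplex.ιTensorObj (sysComplex M) (sysComplex N) a b n h.2.2).hom (f ⊗ₜ g)) T =
      f.altEvalAt (frontWord T.1 (crossCard h T)) (fstProj T.1) ⊗ₜ[A] g.altEvalAt (backWord T.1 (crossCard h T)) (sndProj T.1) := by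
  rw [cross_totalTensorIso_f_ιTensorObj]
  exact crossComponent_tensorCochainEquiv_tmul h f g T

/-! ## §2 On classes -/

/-- **`Hⁿ(totalTensorIso ≫ ×) (κ_{a,b} ([z] ⊗ [w]))` is the class of `cyclesMap (totalTensorIso ≫ ×) (z ⊗ w)`**
(★ `homologyπ_tensor_kunnethComponent`: `κ ([z] ⊗ [w]) = [z ⊗ w]`; Mathlib `homologyπ_naturality`). [cite: Weibel1994, Thm. 3.6.3]
[cite: StacksProject, Tag 0BEC] -/
theorem homologyMap_cross_totalTensorIso_kunnethComponent_π (a b n : ℤ) (h : a + b = n) (z : (sysComplex M).cycles a)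
    (w : (sysComplex N).cycles b) :
    (HomologicalComplex.homologyMap ((totalTensorIso M N).hom ≫
        totalDescHom (sysBicomplex (prodSystem M N)) (sysComplex (lexSystem (prodSystem M N)))
          (fun a b n => ModuleCat.ofHom (crossComponent (prodSystem M N) a b n)) (crossComponent_comm (prodSystem M N))) n).hom
      ((kunnethComponent (sysComplex M) (sysComplex N) a b n h).hom
        (((sysComplex M).homologyπ a).hom z ⊗ₜ ((sysComplex N).homologyπ b).hom w)) =
      ((sysComplex (lexSystem (prodSystem M N))).homologyπ n).hom
        ((cyclesMap ((totalTensorIso M N).hom ≫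
            totalDescHom (sysBicomplex (prodSystem M N)) (sysComplex (lexSystem (prodSystem M N)))
              (fun a b n => ModuleCat.ofHom (crossComponent (prodSystem M N) a b n)) (crossComponent_comm (prodSystem M N))) n).hom
          ((cyclesTensorToCycles (sysComplex M) (sysComplex N) a b n h).hom (z ⊗ₜ w))) := by
  -- `κ ([z] ⊗ [w]) = π (z ⊗ w)`
  have hκ := congrArg (fun ψ => ψ.hom (z ⊗ₜ w)) (homologyπ_tensor_kunnethComponent (sysComplex M) (sysComplex N) a b n h)
  simp only [ModuleCat.hom_comp, LinearMap.comp_apply, ModuleCat.MonoidalCategory.tensorHom_tmul] at hκ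
  rw [hκ, cyclesTensorToHomology, ModuleCat.hom_comp, LinearMap.comp_apply, ← LinearMap.comp_apply, ← ModuleCat.hom_comp,
    HomologicalComplex.homologyπ_naturality, ModuleCat.hom_comp, LinearMap.comp_apply]

/-- … and the underlying cochain of that cycle is `crossComponent (M ⊠ N) a b n (tensorCochainEquiv (z ⊗ w))` (Mathlib `cyclesMap_i`, ★
`cyclesTensorToCycles_i`, §1). [cite: Weibel1994, Thm. 3.6.3] [cite: EilenbergMacLane1953, §5] -/
theorem iCycles_cyclesMap_cross_totalTensorIso_cyclesTensorToCycles (a b n : ℤ) (h : a + b = n) (z : (sysComplex M).cycles a)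
    (w : (sysComplex N).cycles b) :
    ((sysComplex (lexSystem (prodSystem M N))).iCycles n).hom
      ((cyclesMap ((totalTensorIso M N).hom ≫
          totalDescHom (sysBicomplex (prodSystem M N)) (sysComplex (lexSystem (prodSystem M N)))
            (fun a b n => ModuleCat.ofHom (crossComponent (prodSystem M N) a b n)) (crossComponent_comm (prodSystem M N))) n).hom
        ((cyclesTensorToCycles (sysComplex M) (sysComplex N) a b n h).hom (z ⊗ₜ w))) =
      crossComponent (prodSystem M N) a b n
        (tensorCochainEquiv M N a b (((sysComplex M).iCycles a).hom z ⊗ₜ ((sysComplex N).iCycles b).hom w)) := by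
  change ((cyclesMap ((totalTensorIso M N).hom ≫
      totalDescHom (sysBicomplex (prodSystem M N)) (sysComplex (lexSystem (prodSystem M N)))
        (fun a b n => ModuleCat.ofHom (crossComponent (prodSystem M N) a b n)) (crossComponent_comm (prodSystem M N))) n ≫
      (sysComplex (lexSystem (prodSystem M N))).iCycles n).hom
        ((cyclesTensorToCycles (sysComplex M) (sysComplex N) a b n h).hom (z ⊗ₜ w))) = _
  rw [HomologicalComplex.cyclesMap_i]
  change (((totalTensorIso M N).hom ≫
      totalDescHom (sysBicomplex (prodSystem M N)) (sysComplex (lexSystem (prodSystem M N)))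
        (fun a b n => ModuleCat.ofHom (crossComponent (prodSystem M N) a b n)) (crossComponent_comm (prodSystem M N))).f n).hom
      ((cyclesTensorToCycles (sysComplex M) (sysComplex N) a b n h ≫
        (HomologicalComplex.tensorObj (sysComplex M) (sysComplex N)).iCycles n).hom (z ⊗ₜ w)) = _
  rw [cyclesTensorToCycles_i, cyclesTensorι, ModuleCat.hom_comp, LinearMap.comp_apply, ModuleCat.MonoidalCategory.tensorHom_tmul,
    cross_totalTensorIso_f_ιTensorObj]

/-- **The two together, on pure tensors of classes in non-negative bidegree**: `Hⁿ(totalTensorIso ≫ ×) (κ_{a,b} ([z] ⊗ [w]))` is the class of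
A cycle whose cochain at a chain `T` is `z(π₁-front word)| ⊗ w(π₂-back word)|` — the form a geometric consumer compares, via `cycles_ext`,
with the cup product of the two pulled-back cocycles. [cite: StacksProject, Tag 0BEC] [cite: EilenbergMacLane1953, §5] [cite: Weibel1994, Thm. 3.6.3] -/
theorem exists_cycles_homologyMap_cross_kunnethComponent_π {a b n : ℤ} (h : 0 ≤ a ∧ 0 ≤ b ∧ a + b = n) (z : (sysComplex M).cycles a)
    (w : (sysComplex N).cycles b) :
    ∃ c : (sysComplex (lexSystem (prodSystem M N))).cycles n,
      (HomologicalComplex.homologyMap ((totalTensorIso M N).hom ≫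
          totalDescHom (sysBicomplex (prodSystem M N)) (sysComplex (lexSystem (prodSystem M N)))
            (fun a b n => ModuleCat.ofHom (crossComponent (prodSystem M N) a b n)) (crossComponent_comm (prodSystem M N))) n).hom
        ((kunnethComponent (sysComplex M) (sysComplex N) a b n h.2.2).hom
          (((sysComplex M).homologyπ a).hom z ⊗ₜ ((sysComplex N).homologyπ b).hom w)) =
        ((sysComplex (lexSystem (prodSystem M N))).homologyπ n).hom c ∧
      ∀ T : Simplex (ι ×ₗ κ) n, ((sysComplex (lexSystem (prodSystem M N))).iCycles n).hom c T =
        (((sysComplex M).iCycles a).hom z).altEvalAt (frontWord T.1 (crossCard h T)) (fstProj T.1) ⊗ₜ[A]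
          (((sysComplex N).iCycles b).hom w).altEvalAt (backWord T.1 (crossCard h T)) (sndProj T.1) := by
  refine ⟨_, homologyMap_cross_totalTensorIso_kunnethComponent_π M N a b n h.2.2 z w, fun T => ?_⟩
  rw [iCycles_cyclesMap_cross_totalTensorIso_cyclesTensorToCycles]
  exact crossComponent_tensorCochainEquiv_tmul h _ _ T

end OrderedCech

end Literature.Algebra.Homology

end
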